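import Literature.NumberTheory.LFunctions.Zhang2022.RepairRplusJoint
import Literature.NumberTheory.LFunctions.Zhang2022.KnifeEdgeThreshold

/-!
# Zhang (2022), barrier-extension programme — THREE pieces: two in-class pieces with independent scalars over one
# (rough) overhang, and the JOINT currency on the rough class

Y. Zhang, *Discrete mean estimates and the Landau–Siegel zero*, arXiv:2211.02515v1 (2022) [Zhang2022LandauSiegel] —
**unrefereed, under adjudication. WHAT THIS IS NOT: no claim about its Theorems 1–2, Landau–Siegel zeros, Parity or a
repaired `Margin232`; every statement is about the CONTINUED CALCULUS of the manuscript's main terms in an abstract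
off-diagonal world `X` (registry E-017 / E-002 open off `R`).** Cell `landau-siegel` §E, seat p1, stub S-E-p1-7
(planner 2026-08-26T17:48:39Z: «YES, without a new E*-slot»).

The in-class pieces (`KnifeEdge.InClassPiece`) form a complex SUBSPACE (`InClassPiece.add_smul`). p457552's slots on a
piece class `V` — `BandNonnegOn V θ X` (E-005), `CrossSubordinateOn V θ X` (E-006), together `↔ NullOn V θ X`
(`nullOn_iff`) — quantify over ALL in-class pieces; at the combined piece `w = s·u + t·f` they say the completed
constant of the THREE-piece design `s·u + t·f + v` is not negative (`not_threePiece_neg_of_slots`,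
`familyRoughThreePiece`): the exclusion «several in-class pieces with independent scalars» declared in p457552's
docstring IS covered by the same two slots (any finite number of pieces by iterating `add_smul`).

The JOINT currency of `RepairRplusJoint` (p457753) — `C₂₃₂·𝔅(f) < ‖𝔡+𝔡′‖²`, `𝔡+𝔡′ = Repair.twoPieceCross θ X u u′ v v′ s
f f′` — is Cauchy–Schwarz failure of the `2×2` Gram of `(s·u + v, f)`, i.e. NEGATIVITY OF THE PENCIL
`τ ↦ C₂₃₂ + 2Re(conj τ·(𝔡+𝔡′)) + |τ|²𝔅(f)` at some `τ` (`pencil_neg_iff`, pure algebra, threshold kind). The pencil IS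
the completed constant of `s·u + τ·f + v` (`twoPieceMainTerm_combo`) PROVIDED the world reads the combined in-class
piece linearly, `X(s·u + τ·f, v) = s·X(u,v) + τ·X(f,v)`: the displayed CONSISTENCY CONDITION `WorldLinearOn V X` — not
an estimate; p442741's constant of `s·u ⊕ v` already reads `s·X(u,v)`, every sesquilinear world (`X = 0`, every
invisible world: `worldLinearOn_of_invisible`, `worldLinearOn_zero`) satisfies it, and without it the numbers `X(f,v)`
(read by `twoPieceCross`) and `X(s·u+τ·f, v)` (read by the slots) are unrelated. Hence `not_jointCloses_of_slots` and
`familyRoughTwoPieceJoint` (slots E-005/E-006 as in row 7 of the class of record + the consistency condition); the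
three hypotheses are jointly inhabited (`exists_linear_slots_rough`, a LINEAR cancelling world) and load-bearing
(`familyRoughTwoPieceJoint_slots_loadBearing`: at the linear world `X = 0` the criterion closes on a member,
`Repair.jointCloses_zero`, and E-006 fails, `not_crossSubordinateOn_rough_zero`); C2: `OverhangPiece.rough` +
`slots_of_invisible` give back p457753's smooth verdict (`not_jointCloses_of_invisible_again`).
[cite: Zhang2022LandauSiegel, §7 (7.2) p.44; §8 (8.11)–(8.12); §2 (2.18), (2.32)–(2.33)]
-/

noncomputable section

open Real Complex ComplexConjugate Set intervalIntegral
open _root_.MeasureTheory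

namespace Literature.NumberTheory.LFunctions.Zhang2022

namespace KnifeEdge

open Repair

variable {θ : ℝ} {X : PairFunctional} {u u' f f' v v' : ℝ → ℂ}

/-- **In-class pieces form a complex subspace**: `s·u + t·f` (with marked derivative `s·u′ + t·f′`) is an in-class
piece whenever `u`, `f` are. [cite: Zhang2022LandauSiegel, §7 Prop 7.1 p.44, (7.2)] -/
theorem InClassPiece.add_smul (hu : InClassPiece u u') (hf : InClassPiece f f') (s t : ℂ) :
    InClassPiece (fun x => s * u x + t * f x) (fun x => s * u' x + t * f' x) where
  kinked := (hu.kinked.smul s).add_smul hf.kinked t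
  vanish := fun y hy => by simp [hu.vanish y hy, hf.vanish y hy]
  vanish' := fun y hy => by simp [hu.vanish' y hy, hf.vanish' y hy]

/-- **The tail functional is linear**: `L(s·u + t·f) = s·L(u) + t·L(f)` (`L(w) = 12(w(1) − w(0)) + 24πi∫₀¹w`).
[cite: Zhang2022LandauSiegel, §7 Prop 7.1 p.44, (8.11)–(8.12)] -/
theorem tailFunctional_add_smul (hu : InClassPiece u u') (hf : InClassPiece f f') (s t : ℂ) :
    tailFunctional (fun x => s * u x + t * f x) = s * tailFunctional u + t * tailFunctional f := by
  have iu : IntervalIntegrable u volume 0 1 := hu.kinked.cont.intervalIntegrable_of_Icc zero_le_one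
  have ifl : IntervalIntegrable f volume 0 1 := hf.kinked.cont.intervalIntegrable_of_Icc zero_le_one
  unfold tailFunctional
  rw [intervalIntegral.integral_add (iu.const_mul s) (ifl.const_mul t), intervalIntegral.integral_const_mul,
    intervalIntegral.integral_const_mul]
  ring

/-- `P(s·u, f) = s·P(u,f)` (linearity of the polar form in its first slot, on `H¹`).
[cite: Zhang2022LandauSiegel, §2 (2.18)] -/
theorem mainTermFormPolar_smul_left (hu : IsH1OnUnitInterval u u') (hf : IsH1OnUnitInterval f f') (s : ℂ) :
    mainTermFormPolar (fun x => s * u x) (fun x => s * u' x) f f' = s * mainTermFormPolar u u' f f' := by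
  unfold mainTermFormPolar
  rw [mainTermFormSesq_smul_left hu hf, mainTermFormSesq_smul_right hf hu, map_mul, Complex.conj_conj]
  ring

/-- `𝔅(s·u) = |s|²·𝔅(u)` on `H¹`. [cite: Zhang2022LandauSiegel, §2 (2.18)] -/
theorem mainTermForm_smul (hu : IsH1OnUnitInterval u u') (s : ℂ) :
    mainTermForm (fun x => s * u x) (fun x => s * u' x) = ‖s‖ ^ 2 * mainTermForm u u' := by
  have hsu : IsH1OnUnitInterval (fun x => s * u x) (fun x => s * u' x) := by
    simpa using (kinkedProfile_zero.isH1).add_smul hu s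
  have h1 : (mainTermForm (fun x => s * u x) (fun x => s * u' x) : ℂ)
      = ((‖s‖ ^ 2 * mainTermForm u u' : ℝ) : ℂ) := by
    rw [← mainTermFormPolar_self, mainTermFormPolar_smul_left hu hsu, mainTermFormPolar_swap,
      mainTermFormPolar_smul_left hu hu, mainTermFormPolar_self, map_mul, Complex.conj_ofReal,
      ← mul_assoc, Complex.mul_conj']
    push_cast
    ring
  exact_mod_cast h1

/-- **`𝔅` of the combined in-class piece**: `𝔅(s·u + τ·f) = |s|²𝔅(u) + 2Re(conj τ · s·P(u,f)) + |τ|²𝔅(f)`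
(polarisation, `mainTermForm_add_smul`, along the scalar `s`). [cite: Zhang2022LandauSiegel, §2 (2.18)] -/
theorem mainTermForm_smul_add_smul (hu : IsH1OnUnitInterval u u') (hf : IsH1OnUnitInterval f f') (s τ : ℂ) :
    mainTermForm (fun x => s * u x + τ * f x) (fun x => s * u' x + τ * f' x)
      = ‖s‖ ^ 2 * mainTermForm u u' + 2 * (conj τ * (s * mainTermFormPolar u u' f f')).re
        + ‖τ‖ ^ 2 * mainTermForm f f' := by
  have hsu : IsH1OnUnitInterval (fun x => s * u x) (fun x => s * u' x) := by
    simpa using (kinkedProfile_zero.isH1).add_smul hu s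
  rw [mainTermForm_add_smul hsu hf τ, mainTermForm_smul hu, mainTermFormPolar_smul_left hu hf]

/-- **The three-piece pencil** of the design `s·u ⊕ v` against the in-class piece `f` with scalar `τ`:
`C₂₃₂ + 2Re(conj τ·(𝔡+𝔡′)) + |τ|²𝔅(f)` (`C₂₃₂ = twoPieceMainTerm`, `𝔡+𝔡′ = Repair.twoPieceCross`) — under
`WorldLinearOn` the completed constant of the three-piece design `s·u + τ·f + v` (`twoPieceMainTerm_combo`).
[cite: Zhang2022LandauSiegel, §7 Prop 7.1 p.44, (7.2); §2 (2.18)] -/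
def threePieceMainTerm (θ : ℝ) (X : PairFunctional) (u u' f f' v v' : ℝ → ℂ) (s τ : ℂ) : ℝ :=
  twoPieceMainTerm θ X u u' v v' s + 2 * (conj τ * twoPieceCross θ X u u' v v' s f f').re
    + ‖τ‖ ^ 2 * mainTermForm f f'

/-- **Consistency condition on the world** (displayed; NOT an estimate): against every overhang piece of the class
`V`, the world is linear in the in-class slot — `X(s·u + t·f, v) = s·X(u,v) + t·X(f,v)`. p442741's constant of the
design `s·u ⊕ v` already reads `s·X(u,v)`, so this is the convention that makes the `X`-world constants of designs
with several in-class pieces well defined; every sesquilinear world (e.g. `X = 0`, every invisible world) satisfies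
it. [cite: Zhang2022LandauSiegel, §7 Prop 7.1 p.44, (7.2)] -/
def WorldLinearOn (V : PieceClass) (X : PairFunctional) : Prop :=
  ∀ (u u' f f' v v' : ℝ → ℂ) (s t : ℂ), InClassPiece u u' → InClassPiece f f' → V v v' →
    X (fun x => s * u x + t * f x) (fun x => s * u' x + t * f' x) v v' = s * X u u' v v' + t * X f f' v v'

/-- **The pencil is the three-piece constant** (under the consistency condition): for in-class `u, f`, `v ∈ V`,
`twoPieceMainTerm θ X (s·u+τ·f) (s·u′+τ·f′) v v′ 1 = threePieceMainTerm θ X u u′ f f′ v v′ s τ`.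
[cite: Zhang2022LandauSiegel, §7 Prop 7.1 p.44, (7.2); §8 (8.11)–(8.12)] -/
theorem twoPieceMainTerm_combo {V : PieceClass} (hX : WorldLinearOn V X) (hu : InClassPiece u u')
    (hf : InClassPiece f f') (hv : V v v') (s τ : ℂ) :
    twoPieceMainTerm θ X (fun x => s * u x + τ * f x) (fun x => s * u' x + τ * f' x) v v' 1
      = threePieceMainTerm θ X u u' f f' v v' s τ := by
  unfold threePieceMainTerm twoPieceMainTerm twoPieceCross
  rw [mainTermForm_smul_add_smul hu.kinked.isH1 hf.kinked.isH1, tailFunctional_add_smul hu hf,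
    hX u u' f f' v v' s τ hu hf hv]
  set P := mainTermFormPolar u u' f f'
  set Lu := tailFunctional u
  set Lf := tailFunctional f
  set Φ := conj (overhangMass θ v)
  set Xu := X u u' v v'
  set Xf := X f f' v v'
  have e1 : ((1 : ℂ) * ((π : ℂ) * Φ * (s * Lu + τ * Lf) + (s * Xu + τ * Xf))).re
      = (s * ((π : ℂ) * Φ * Lu + Xu)).re + (τ * ((π : ℂ) * Φ * Lf + Xf)).re := by
    rw [← Complex.add_re]; congr 1; ring
  have e2 : (conj τ * (s * P + conj ((π : ℂ) * Φ * Lf + Xf))).re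
      = (conj τ * (s * P)).re + (τ * ((π : ℂ) * Φ * Lf + Xf)).re := by
    have : conj τ * (s * P + conj ((π : ℂ) * Φ * Lf + Xf))
        = conj τ * (s * P) + conj (τ * ((π : ℂ) * Φ * Lf + Xf)) := by rw [map_mul]; ring
    rw [this, Complex.add_re, Complex.conj_re]
  rw [e1, e2, norm_one]
  ring

/-- `conj c · c = ‖c‖²` as a real part, and `‖τ‖`-bookkeeping (private helpers inlined below). **Joint ⇒ pencil
negative**: if `q·B < ‖c‖²` with `B ≥ 0` then `q + 2Re(conj τ·c) + |τ|²B < 0` for some `τ` (`τ = −c/B` if `B > 0`,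
`τ = −((q+1)/(2‖c‖²))·c` if `B = 0`). [folklore] -/
private theorem pencil_neg_of_joint {q B : ℝ} {c : ℂ} (hB : 0 ≤ B) (h : q * B < ‖c‖ ^ 2) :
    ∃ τ : ℂ, q + 2 * (conj τ * c).re + ‖τ‖ ^ 2 * B < 0 := by
  have hcc : ((conj c * c).re : ℝ) = ‖c‖ ^ 2 := by
    rw [Complex.conj_mul' c]; norm_cast
  rcases hB.eq_or_lt with hB0 | hBpos
  · -- `B = 0`: `c ≠ 0`, move along `−c`
    subst hB0
    have hc2 : 0 < ‖c‖ ^ 2 := by simpa using h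
    refine ⟨-(((q + 1) / (2 * ‖c‖ ^ 2) : ℝ) : ℂ) * c, ?_⟩
    have hc0 : ‖c‖ ≠ 0 := fun h0 => by rw [h0] at hc2; simp at hc2
    have e : (conj (-(((q + 1) / (2 * ‖c‖ ^ 2) : ℝ) : ℂ) * c) * c).re = -((q + 1) / (2 * ‖c‖ ^ 2)) * ‖c‖ ^ 2 := by
      rw [map_mul, map_neg, Complex.conj_ofReal, neg_mul, neg_mul, Complex.neg_re, mul_assoc,
        Complex.re_ofReal_mul, hcc, neg_mul]
    rw [e, mul_zero, add_zero]
    have : (q + 1) / (2 * ‖c‖ ^ 2) * ‖c‖ ^ 2 = (q + 1) / 2 := by field_simp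
    nlinarith [this]
  · -- `B > 0`: `τ = −c/B`
    refine ⟨-(c / (B : ℂ)), ?_⟩
    have e1 : (conj (-(c / (B : ℂ))) * c).re = -(‖c‖ ^ 2 / B) := by
      rw [map_neg, map_div₀, Complex.conj_ofReal, neg_mul, Complex.neg_re, div_mul_eq_mul_div,
        Complex.div_ofReal_re, hcc]
    have e2 : ‖-(c / (B : ℂ))‖ ^ 2 * B = ‖c‖ ^ 2 / B := by
      rw [norm_neg, norm_div, Complex.norm_real, Real.norm_eq_abs, abs_of_pos hBpos, div_pow]
      field_simp
    rw [e1, e2]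
    have : q < ‖c‖ ^ 2 / B := by rw [lt_div_iff₀ hBpos]; exact h
    linarith

/-- **No joint closing ⇒ pencil non-negative**: if `0 ≤ q`, `0 ≤ B` and `‖c‖² ≤ q·B` then
`0 ≤ q + 2Re(conj τ·c) + |τ|²B` for every `τ`. [folklore] -/
private theorem pencil_nonneg_of_not_joint {q B : ℝ} {c : ℂ} (hq : 0 ≤ q) (hB : 0 ≤ B) (h : ‖c‖ ^ 2 ≤ q * B)
    (τ : ℂ) : 0 ≤ q + 2 * (conj τ * c).re + ‖τ‖ ^ 2 * B := by
  have hre : -(‖τ‖ * ‖c‖) ≤ (conj τ * c).re := by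
    have := Complex.abs_re_le_norm (conj τ * c)
    rw [norm_mul, Complex.norm_conj] at this
    exact (abs_le.1 this).1
  rcases hB.eq_or_lt with hB0 | hBpos
  · subst hB0
    have hc : ‖c‖ = 0 := by nlinarith [norm_nonneg c]
    have : c = 0 := norm_eq_zero.1 hc
    subst this
    simpa using hq
  · have key : 0 ≤ B * (q + 2 * (conj τ * c).re + ‖τ‖ ^ 2 * B) := by
      nlinarith [sq_nonneg (‖c‖ - ‖τ‖ * B), norm_nonneg c, norm_nonneg τ]
    by_contra hQ
    push Not at hQ
    have := mul_neg_of_pos_of_neg hBpos hQ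
    linarith

/-- **THRESHOLD (pure algebra): the pencil is negative somewhere iff the design closes in the POS currency
(`q < 0`) or in the JOINT currency (`q·B < ‖c‖²`)**, for `B ≥ 0` — the algebra of the §2 endgame's two closing
criteria for a design with one more in-class scalar. [cite: Zhang2022LandauSiegel, §2 (2.18), (2.32)–(2.33)] -/
theorem pencil_neg_iff {q B : ℝ} {c : ℂ} (hB : 0 ≤ B) :
    (∃ τ : ℂ, q + 2 * (conj τ * c).re + ‖τ‖ ^ 2 * B < 0) ↔ q < 0 ∨ q * B < ‖c‖ ^ 2 := by
  constructor
  · rintro ⟨τ, hτ⟩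
    by_contra hcon
    push Not at hcon
    exact absurd hτ (not_lt.2 (pencil_nonneg_of_not_joint hcon.1 hB hcon.2 τ))
  · rintro (hq | hj)
    · exact ⟨0, by simpa using hq⟩
    · exact pencil_neg_of_joint hB hj

/-- **Two in-class pieces with independent scalars over one overhang are covered by the two slots**: on a piece
class `V` with `BandNonnegOn V θ X` and `CrossSubordinateOn V θ X` (E-005 / E-006, equivalently `NullOn V θ X`),
the completed constant of `s·u + t·f + v` is not negative — the slots quantify over the in-class piece `s·u + t·f`.
(This retires the exclusion «several in-class pieces with independent scalars» of p457552's docstring, for two and,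
by iteration, any finite number of pieces.) [cite: Zhang2022LandauSiegel, §7 Prop 7.1 p.44, (7.2)] -/
theorem not_threePiece_neg_of_slots {V : PieceClass} (hB : BandNonnegOn V θ X) (hC : CrossSubordinateOn V θ X)
    (hu : InClassPiece u u') (hf : InClassPiece f f') (hv : V v v') (s t : ℂ) :
    ¬ (twoPieceMainTerm θ X (fun x => s * u x + t * f x) (fun x => s * u' x + t * f' x) v v' 1 < 0) :=
  not_lt.2 (nullOn_iff.2 ⟨hB, hC⟩ _ _ _ _ 1 (hu.add_smul hf s t) hv)

/-- **No joint closing under the null of the class** (and the consistency condition): if `NullOn V θ X` and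
`WorldLinearOn V θ X`, then for in-class `u`, `f`, `v ∈ V` and every `s`,
`¬ (twoPieceMainTerm θ X u u′ v v′ s · 𝔅(f) < ‖twoPieceCross θ X u u′ v v′ s f f′‖²)` — joint closing would make the
pencil negative at some `τ`, i.e. the completed constant of the in-class piece `s·u + τ·f` over `v` negative,
against the null. [cite: Zhang2022LandauSiegel, §2 (2.32)–(2.33); §7 Prop 7.1 p.44, (7.2)] -/
theorem not_jointCloses_of_nullOn {V : PieceClass} (hX : WorldLinearOn V X) (hN : NullOn V θ X)
    (hu : InClassPiece u u') (hf : InClassPiece f f') (hv : V v v') (s : ℂ) :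
    ¬ (twoPieceMainTerm θ X u u' v v' s * mainTermForm f f' < ‖twoPieceCross θ X u u' v v' s f f'‖ ^ 2) := by
  intro h
  obtain ⟨τ, hτ⟩ := pencil_neg_of_joint (mainTermForm_nonneg_of_isH1 hf.kinked.isH1) h
  have h0 := hN _ _ _ _ 1 (hu.add_smul hf s τ) hv
  rw [twoPieceMainTerm_combo hX hu hf hv s τ] at h0
  unfold threePieceMainTerm at h0
  linarith

/-- The same with the two slots E-005 / E-006 as hypotheses (`nullOn_iff`).
[cite: Zhang2022LandauSiegel, §2 (2.32)–(2.33); §7 Prop 7.1 p.44, (7.2)] -/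
theorem not_jointCloses_of_slots {V : PieceClass} (hX : WorldLinearOn V X) (hB : BandNonnegOn V θ X)
    (hC : CrossSubordinateOn V θ X) (hu : InClassPiece u u') (hf : InClassPiece f f') (hv : V v v') (s : ℂ) :
    ¬ (twoPieceMainTerm θ X u u' v v' s * mainTermForm f f' < ‖twoPieceCross θ X u u' v v' s f f'‖ ^ 2) :=
  not_jointCloses_of_nullOn hX (nullOn_iff.2 ⟨hB, hC⟩) hu hf hv s

/-- An invisible world is linear in the in-class slot against smooth overhang pieces (`X(w,v) = −π·conj Φ_v·L(w)`
with `L` linear). [cite: Zhang2022LandauSiegel, §7 Prop 7.1 p.44, (7.2)] -/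
theorem worldLinearOn_of_invisible (h : InvisibleOverhang θ X) : WorldLinearOn (OverhangPiece θ) X := by
  intro u u' f f' v v' s t hu hf hv
  rw [(h _ _ v v' (hu.add_smul hf s t) hv).1, (h u u' v v' hu hv).1, (h f f' v v' hf hv).1,
    tailFunctional_add_smul hu hf]
  ring

/-- `X = 0` is linear on every class. [cite: Zhang2022LandauSiegel, §7 Prop 7.1 p.44, (7.2)] -/
theorem worldLinearOn_zero (V : PieceClass) : WorldLinearOn V 0 := by
  intro u u' f f' v v' s t _ _ _
  simp

/-- C2 by term: on the smooth class in an invisible world the general theorem gives back p457753's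
`Repair.not_jointCloses_of_invisible`. [cite: Zhang2022LandauSiegel, §2 (2.32)–(2.33); §7 Prop 7.1 p.44, (7.2)] -/
theorem not_jointCloses_of_invisible_again (h : InvisibleOverhang θ X) (hu : InClassPiece u u')
    (hv : OverhangPiece θ v v') (hf : InClassPiece f f') (s : ℂ) :
    ¬ (twoPieceMainTerm θ X u u' v v' s * mainTermForm f f' < ‖twoPieceCross θ X u u' v v' s f f'‖ ^ 2) :=
  not_jointCloses_of_slots (worldLinearOn_of_invisible h) (slots_of_invisible h).1 (slots_of_invisible h).2
    hu hf hv s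

/-- **A LINEAR cancelling world on the rough class**: the three displayed hypotheses of `familyRoughTwoPieceJoint`'s
verdict — `WorldLinearOn`, `BandNonnegOn` (E-005), `CrossSubordinateOn` (E-006) on `RoughOverhangPiece θ` — hold
together for some world, for every `θ` (the world corrects every `(in-class, rough)` pairing by minus the tail coupling,
linearly, and nets every genuinely rough diagonal block to zero). So the verdict is not vacuous; with
`familyRoughTwoPieceJoint_slots_loadBearing` (they fail together at the linear world `X = 0`, where the criterion
closes) the slots are inhabited ∧ load-bearing (REF-E C3(c′)). [cite: Zhang2022LandauSiegel, §7 Prop 7.1 p.44, (7.2)] -/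
theorem exists_linear_slots_rough (θ : ℝ) :
    ∃ X : PairFunctional, WorldLinearOn (RoughOverhangPiece θ) X ∧
      BandNonnegOn (RoughOverhangPiece θ) θ X ∧ CrossSubordinateOn (RoughOverhangPiece θ) θ X := by
  classical
  set X : PairFunctional := fun a a' c c' =>
    if RoughOverhangPiece θ a a' ∧ a = c ∧ a' = c' ∧ ¬ InClassPiece a a'
      then (((-(topDiagForm θ c c').re / 2 : ℝ)) : ℂ)
      else -((π : ℂ) * conj (overhangMass θ c) * tailFunctional a) with hX
  -- on (in-class, rough) pairs the world is the (linear) tail canceller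
  have hin : ∀ a a' c c', InClassPiece a a' → X a a' c c' = -((π : ℂ) * conj (overhangMass θ c) * tailFunctional a) := by
    intro a a' c c' ha
    simp [hX, ha]
  -- every net rough block is zero
  have hband : ∀ c c', RoughOverhangPiece θ c c' → netOverhangBlock θ X c c' = 0 := by
    intro c c' hc
    unfold netOverhangBlock
    by_cases hi : InClassPiece c c'
    · obtain ⟨h0, h0'⟩ := eq_zero_of_inClass_of_rough hi hc
      subst h0 h0'
      rw [hin _ _ _ _ hi]
      simp [topDiagForm, MformTop, dipoleIntegrandTop, overhangMass, tailFunctional]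
    · have : X c c' c c' = (((-(topDiagForm θ c c').re / 2 : ℝ)) : ℂ) := by simp [hX, hc, hi]
      rw [this, Complex.ofReal_re]
      ring
  refine ⟨X, ?_, ?_, ?_⟩
  · intro u u' f f' v v' s t hu hf _
    rw [hin _ _ _ _ (hu.add_smul hf s t), hin _ _ _ _ hu, hin _ _ _ _ hf, tailFunctional_add_smul hu hf]
    ring
  · intro v v' hv
    rw [hband v v' hv]
  · intro u u' v v' hu hv
    unfold crossResidual
    rw [hin _ _ _ _ hu, add_neg_cancel, norm_zero, hband v v' hv, mul_zero]
    norm_num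

/-- A three-piece design: two in-class pieces `u`, `f` with independent scalars `s`, `t`, one overhang piece `v` of
length `θ`. [cite: Zhang2022LandauSiegel, §2 (2.23)–(2.28); §7 (7.2) p.44] -/
structure ThreePieceDesign : Type where
  /-- logarithmic length of the overhang -/
  θ : ℝ
  /-- first in-class piece and its marked right derivative -/
  u : ℝ → ℂ
  u' : ℝ → ℂ
  /-- second in-class piece and its marked right derivative -/
  f : ℝ → ℂ
  f' : ℝ → ℂ
  /-- overhang piece and its marked right derivative -/
  v : ℝ → ℂ
  v' : ℝ → ℂ
  /-- the two scalars -/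
  s : ℂ
  t : ℂ

/-- **family «rough three-piece, POS currency»**: K = `1 ≤ θ ∧ InClassPiece u u′ ∧ InClassPiece f f′ ∧
RoughOverhangPiece θ v v′` (wall jump / top value / interior jumps of `v` allowed; no analytic hypothesis); V = for
EVERY world `X` with the displayed slots `BandNonnegOn` (E-005) and `CrossSubordinateOn` (E-006) on the rough class,
the completed constant of `s·u + t·f + v` is not negative. [cite: Zhang2022LandauSiegel, §7 (7.2) p.44] -/
def familyRoughThreePiece : DesignFamily where
  Design := ThreePieceDesign
  InClass d := 1 ≤ d.θ ∧ InClassPiece d.u d.u' ∧ InClassPiece d.f d.f' ∧ RoughOverhangPiece d.θ d.v d.v'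
  Verdict d := ∀ X : PairFunctional, BandNonnegOn (RoughOverhangPiece d.θ) d.θ X →
    CrossSubordinateOn (RoughOverhangPiece d.θ) d.θ X →
      ¬ (twoPieceMainTerm d.θ X (fun x => d.s * d.u x + d.t * d.f x) (fun x => d.s * d.u' x + d.t * d.f' x)
            d.v d.v' 1 < 0)

/-- **`familyRoughThreePiece` is decided** (`not_threePiece_neg_of_slots`). [cite: Zhang2022LandauSiegel, §7 (7.2) p.44] -/
theorem familyRoughThreePiece_decided : familyRoughThreePiece.Decided :=
  fun d h _ hB hC => not_threePiece_neg_of_slots hB hC h.2.1 h.2.2.1 h.2.2.2 d.s d.t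

/-- **family «rough two-piece against an in-class probe, JOINT currency»**: designs `Repair.JointDesign`;
K = `1 ≤ θ ∧ InClassPiece u u′ ∧ RoughOverhangPiece θ v v′ ∧ InClassPiece f f′`; V = for EVERY world `X` with
`WorldLinearOn` (consistency, displayed) and the slots `BandNonnegOn` (E-005), `CrossSubordinateOn` (E-006) on the
rough class, `¬ (C₂₃₂·𝔅(f) < ‖𝔡+𝔡′‖²)`. [cite: Zhang2022LandauSiegel, §2 (2.32)–(2.33); §7 (7.2) p.44] -/
def familyRoughTwoPieceJoint : DesignFamily where
  Design := JointDesign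
  InClass d := 1 ≤ d.θ ∧ InClassPiece d.u d.u' ∧ RoughOverhangPiece d.θ d.v d.v' ∧ InClassPiece d.f d.f'
  Verdict d := ∀ X : PairFunctional, WorldLinearOn (RoughOverhangPiece d.θ) X →
    BandNonnegOn (RoughOverhangPiece d.θ) d.θ X → CrossSubordinateOn (RoughOverhangPiece d.θ) d.θ X →
      ¬ (twoPieceMainTerm d.θ X d.u d.u' d.v d.v' d.s * mainTermForm d.f d.f'
          < ‖twoPieceCross d.θ X d.u d.u' d.v d.v' d.s d.f d.f'‖ ^ 2)

/-- **`familyRoughTwoPieceJoint` is decided** (`not_jointCloses_of_slots`).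
[cite: Zhang2022LandauSiegel, §2 (2.32)–(2.33); §7 (7.2) p.44] -/
theorem familyRoughTwoPieceJoint_decided : familyRoughTwoPieceJoint.Decided :=
  fun d h _ hX hB hC => not_jointCloses_of_slots hX hB hC h.2.1 h.2.2.2 h.2.2.1 d.s

/-- C2 at family level: a smooth joint design (`Repair.familyTwoPieceJoint`, row 11 of the class of record) is a rough
joint design (`OverhangPiece.rough`). [cite: Zhang2022LandauSiegel, §7 (7.2) p.44] -/
theorem familyTwoPieceJoint_inClass_toRough (d : JointDesign) (h : familyTwoPieceJoint.InClass d) :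
    familyRoughTwoPieceJoint.InClass d :=
  ⟨h.1, h.2.1, h.2.2.1.rough, h.2.2.2⟩

/-- C4: the member `s·g⋆ + t·ϰ_{1,5/2} ⊕ plateau_θ` (a genuine wall jump) of `familyRoughThreePiece`, every `θ ≥ 1`.
[cite: Zhang2022LandauSiegel, §7 (7.2) p.44] -/
theorem familyRoughThreePiece_inClass_witness (hθ : 1 ≤ θ) (s t : ℂ) :
    familyRoughThreePiece.InClass ⟨θ, gStar, gStar', kappaP 1 (5/2), kappaP' 1 (5/2), plateau θ, fun _ => 0, s, t⟩ :=
  ⟨hθ, inClassPiece_gStar, inClassPiece_kappaP_one (5/2), roughOverhangPiece_plateau θ⟩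

/-- C4: the member `s·g⋆ ⊕ plateau_θ` against the probe `g⋆` of `familyRoughTwoPieceJoint`, every `θ ≥ 1`.
[cite: Zhang2022LandauSiegel, §7 (7.2) p.44] -/
theorem familyRoughTwoPieceJoint_inClass_witness (hθ : 1 ≤ θ) (s : ℂ) :
    familyRoughTwoPieceJoint.InClass ⟨θ, gStar, gStar', plateau θ, fun _ => 0, s, gStar, gStar'⟩ :=
  ⟨hθ, inClassPiece_gStar, roughOverhangPiece_plateau θ, inClassPiece_gStar⟩

/-- **Tightness in the linear world `X = 0`**: the consistency condition holds, the joint criterion CLOSES on the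
class member `s·g⋆ ⊕ φ_θ` against `g⋆` (`Repair.jointCloses_zero`, p457753; `φ_θ` is rough by `OverhangPiece.rough`)
and cross-subordination FAILS (`not_crossSubordinateOn_rough_zero`, p457552) — the slots of
`familyRoughTwoPieceJoint` are load-bearing, for every `θ > 1`. [cite: Zhang2022LandauSiegel, §7 (7.2) p.44] -/
theorem familyRoughTwoPieceJoint_slots_loadBearing (hθ : 1 < θ) (s : ℂ) :
    WorldLinearOn (RoughOverhangPiece θ) 0 ∧
      familyRoughTwoPieceJoint.InClass ⟨θ, gStar, gStar', phiT θ, phiT' θ, s, gStar, gStar'⟩ ∧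
      twoPieceMainTerm θ 0 gStar gStar' (phiT θ) (phiT' θ) s * mainTermForm gStar gStar'
        < ‖twoPieceCross θ 0 gStar gStar' (phiT θ) (phiT' θ) s gStar gStar'‖ ^ 2 ∧
      ¬ CrossSubordinateOn (RoughOverhangPiece θ) θ 0 :=
  ⟨worldLinearOn_zero _, ⟨hθ.le, inClassPiece_gStar, (overhangPiece_phiT hθ.le).rough, inClassPiece_gStar⟩,
    jointCloses_zero hθ s, not_crossSubordinateOn_rough_zero hθ⟩

/-- **`R⁺ ++ [familyRoughThreePiece, familyRoughTwoPieceJoint]` is decided** (for the running assembly).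
[cite: Zhang2022LandauSiegel, §2 (2.32)–(2.33); §7 (7.2) p.44] -/
theorem rplus_threePiece_decided : ClassDecided (Rplus ++ [familyRoughThreePiece, familyRoughTwoPieceJoint]) :=
  classDecided_append.2 ⟨rplus_decided,
    classDecided_cons familyRoughThreePiece_decided (classDecided_cons familyRoughTwoPieceJoint_decided classDecided_nil)⟩

end KnifeEdge

end Literature.NumberTheory.LFunctions.Zhang2022
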